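import Mathlib

/-!
# Endpoint lemma with SHIFTED power factors (for one-face chain certificates)

(prove-1 gen 56, memo run/shared/lean/prim/prim-ineq-prove-1/FINDING-CHAIN-prove1-g56.md §3(B),(D).)  If `A, B, C ≥ 0`, `l₁, l₂ ≥ 0`, `l₀ ∈ ℝ`,
`a_i > 0`, `c_i ≥ 0` with `a_i t₀ > c_i`, and the affine function `A + Bt` lies below `R(t) = C·t^{l₀}·(a₁t − c₁)^{l₁}·(a₂t − c₂)^{l₂}` at
`t = t₀` and at `t = t₁` (`0 < t₀ ≤ t₁`), then it lies below `R` on the whole interval.  Reason: at `t = t₀^a t₁^b` (weighted geometric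
interpolation) `A + Bt ≤ (A+Bt₀)^a(A+Bt₁)^b` and `(a t₀ − c)^a (a t₁ − c)^b ≤ a t − c` — both are the superadditivity of the weighted geometric
mean, i.e. weighted AM–GM.  This is the one-variable step of the vertex reduction for power certificates that price ONE face of the block
(the cell usages become shifted powers of the face usage); the unshifted case is `affine_le_mul_rpow_of_endpoints`. [this work]
-/

namespace Summit.CriticalPhenomena.PercolationContinuityZ3.Theorems.SunflowerPartition.SafeCalc.LinkedCurrency

/-- Superadditivity of the weighted geometric mean: `x₁^a y₁^b + x₂^a y₂^b ≤ (x₁+x₂)^a (y₁+y₂)^b` (`a,b ≥ 0`, `a+b = 1`). [this work] -/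
theorem gm_superadd {x₁ x₂ y₁ y₂ a b : ℝ} (hx₁ : 0 ≤ x₁) (hx₂ : 0 ≤ x₂) (hy₁ : 0 ≤ y₁) (hy₂ : 0 ≤ y₂) (hX : 0 < x₁ + x₂)
    (hY : 0 < y₁ + y₂) (ha : 0 ≤ a) (hb : 0 ≤ b) (hab : a + b = 1) :
    x₁ ^ a * y₁ ^ b + x₂ ^ a * y₂ ^ b ≤ (x₁ + x₂) ^ a * (y₁ + y₂) ^ b := by
  have h1 := Real.geom_mean_le_arith_mean2_weighted ha hb (div_nonneg hx₁ hX.le) (div_nonneg hy₁ hY.le) hab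
  have h2 := Real.geom_mean_le_arith_mean2_weighted ha hb (div_nonneg hx₂ hX.le) (div_nonneg hy₂ hY.le) hab
  rw [Real.div_rpow hx₁ hX.le, Real.div_rpow hy₁ hY.le] at h1
  rw [Real.div_rpow hx₂ hX.le, Real.div_rpow hy₂ hY.le] at h2
  have hXa : 0 < (x₁ + x₂) ^ a := Real.rpow_pos_of_pos hX a
  have hYb : 0 < (y₁ + y₂) ^ b := Real.rpow_pos_of_pos hY b
  have hsum : x₁ ^ a / (x₁ + x₂) ^ a * (y₁ ^ b / (y₁ + y₂) ^ b) + x₂ ^ a / (x₁ + x₂) ^ a * (y₂ ^ b / (y₁ + y₂) ^ b) ≤ 1 := by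
    have hx : a * (x₁ / (x₁ + x₂)) + a * (x₂ / (x₁ + x₂)) = a := by
      rw [← mul_add, ← add_div, div_self (ne_of_gt hX), mul_one]
    have hy : b * (y₁ / (y₁ + y₂)) + b * (y₂ / (y₁ + y₂)) = b := by
      rw [← mul_add, ← add_div, div_self (ne_of_gt hY), mul_one]
    linarith [h1, h2, hx, hy, hab]
  have e : x₁ ^ a / (x₁ + x₂) ^ a * (y₁ ^ b / (y₁ + y₂) ^ b) + x₂ ^ a / (x₁ + x₂) ^ a * (y₂ ^ b / (y₁ + y₂) ^ b) =
      (x₁ ^ a * y₁ ^ b + x₂ ^ a * y₂ ^ b) / ((x₁ + x₂) ^ a * (y₁ + y₂) ^ b) := by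
    field_simp
  rw [e, div_le_one (mul_pos hXa hYb)] at hsum
  exact hsum

/-- Shifted geometric means: `(U − c)^a (V − c)^b ≤ U^a V^b − c` for `0 ≤ c < U, V` (`a,b ≥ 0`, `a+b = 1`). [this work] -/
theorem shifted_gm_le {U V c a b : ℝ} (hc : 0 ≤ c) (hU : c < U) (hV : c < V) (ha : 0 ≤ a) (hb : 0 ≤ b) (hab : a + b = 1) :
    (U - c) ^ a * (V - c) ^ b ≤ U ^ a * V ^ b - c := by
  have h := gm_superadd (sub_nonneg.2 hU.le) hc (sub_nonneg.2 hV.le) hc (by linarith) (by linarith) ha hb hab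
  have hcab : c ^ a * c ^ b = c := by rw [← Real.rpow_add' hc (by rw [hab]; norm_num), hab, Real.rpow_one]
  rw [hcab, sub_add_cancel, sub_add_cancel] at h
  linarith

set_option maxHeartbeats 400000 in
/-- **Shifted endpoint lemma.**  `A + Bt ≤ C t^{l₀} (a₁t − c₁)^{l₁} (a₂t − c₂)^{l₂}` at `t₀` and `t₁` ⟹ on `[t₀, t₁]`. [this work] -/
theorem affine_le_shifted_rpow_of_endpoints {A B C l₀ l₁ l₂ a₁ c₁ a₂ c₂ t₀ t₁ t : ℝ} (hA : 0 ≤ A) (hB : 0 ≤ B) (hC : 0 ≤ C)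
    (hl₁ : 0 ≤ l₁) (hl₂ : 0 ≤ l₂) (ha₁ : 0 < a₁) (hc₁ : 0 ≤ c₁) (ha₂ : 0 < a₂) (hc₂ : 0 ≤ c₂)
    (ht₀ : 0 < t₀) (h₀ : t₀ ≤ t) (h₁ : t ≤ t₁) (hs₁ : c₁ < a₁ * t₀) (hs₂ : c₂ < a₂ * t₀)
    (e₀ : A + B * t₀ ≤ C * t₀ ^ l₀ * (a₁ * t₀ - c₁) ^ l₁ * (a₂ * t₀ - c₂) ^ l₂)
    (e₁ : A + B * t₁ ≤ C * t₁ ^ l₀ * (a₁ * t₁ - c₁) ^ l₁ * (a₂ * t₁ - c₂) ^ l₂) :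
    A + B * t ≤ C * t ^ l₀ * (a₁ * t - c₁) ^ l₁ * (a₂ * t - c₂) ^ l₂ := by
  have ht : 0 < t := lt_of_lt_of_le ht₀ h₀
  have ht₁ : 0 < t₁ := lt_of_lt_of_le ht h₁
  rcases eq_or_lt_of_le (h₀.trans h₁) with heq | hlt
  · have : t = t₀ := le_antisymm (heq ▸ h₁) h₀
    rw [this]; exact e₀
  -- weights
  have hden : 0 < Real.log t₁ - Real.log t₀ := sub_pos.2 (Real.log_lt_log ht₀ hlt)
  obtain ⟨a, hadef⟩ : ∃ x : ℝ, x = (Real.log t₁ - Real.log t) / (Real.log t₁ - Real.log t₀) := ⟨_, rfl⟩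
  obtain ⟨b, hbdef⟩ : ∃ x : ℝ, x = (Real.log t - Real.log t₀) / (Real.log t₁ - Real.log t₀) := ⟨_, rfl⟩
  have ha : 0 ≤ a := by rw [hadef]; exact div_nonneg (sub_nonneg.2 (Real.log_le_log ht h₁)) hden.le
  have hb : 0 ≤ b := by rw [hbdef]; exact div_nonneg (sub_nonneg.2 (Real.log_le_log ht₀ h₀)) hden.le
  have hab : a + b = 1 := by rw [hadef, hbdef, ← add_div]; field_simp; ring
  have hlogt : a * Real.log t₀ + b * Real.log t₁ = Real.log t := by rw [hadef, hbdef]; field_simp; ring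
  -- geometric interpolation of positive numbers along (a, b)
  have gm : ∀ {u v : ℝ}, 0 < u → 0 < v → u ^ a * v ^ b = Real.exp (a * Real.log u + b * Real.log v) := by
    intro u v hu hv
    rw [Real.rpow_def_of_pos hu, Real.rpow_def_of_pos hv, ← Real.exp_add]; ring_nf
  have htab : t₀ ^ a * t₁ ^ b = t := by rw [gm ht₀ ht₁, hlogt, Real.exp_log ht]
  -- useful positivity
  have hs₁' : c₁ < a₁ * t₁ := lt_of_lt_of_le hs₁ (by nlinarith [h₀.trans h₁])
  have hs₂' : c₂ < a₂ * t₁ := lt_of_lt_of_le hs₂ (by nlinarith [h₀.trans h₁])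
  have hs₁t : c₁ < a₁ * t := lt_of_lt_of_le hs₁ (by nlinarith)
  have hs₂t : c₂ < a₂ * t := lt_of_lt_of_le hs₂ (by nlinarith)
  have hR : ∀ {u : ℝ}, 0 < u → c₁ < a₁ * u → c₂ < a₂ * u → 0 ≤ C * u ^ l₀ * (a₁ * u - c₁) ^ l₁ * (a₂ * u - c₂) ^ l₂ :=
    fun hu h1 h2 => mul_nonneg (mul_nonneg (mul_nonneg hC (Real.rpow_nonneg hu.le _)) (Real.rpow_nonneg (by linarith) _))
      (Real.rpow_nonneg (by linarith) _)
  -- degenerate case A = B = 0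
  rcases eq_or_lt_of_le (add_nonneg hA (mul_nonneg hB ht₀.le) : 0 ≤ A + B * t₀) with hzero | hpos
  · have hA0 : A = 0 := by nlinarith [mul_nonneg hB ht₀.le]
    have hB0 : B = 0 := by
      rcases eq_or_lt_of_le hB with e | e
      · exact e.symm
      · exfalso; nlinarith [mul_pos e ht₀]
    rw [hA0, hB0, zero_mul, zero_add]
    exact hR ht hs₁t hs₂t
  have hpos₁ : 0 < A + B * t₁ := lt_of_lt_of_le hpos (by nlinarith [h₀.trans h₁])
  -- Step 1: A + B t ≤ (A+Bt₀)^a (A+Bt₁)^b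
  have step1 : A + B * t ≤ (A + B * t₀) ^ a * (A + B * t₁) ^ b := by
    have h := gm_superadd hA (mul_nonneg hB ht₀.le) hA (mul_nonneg hB ht₁.le) hpos hpos₁ ha hb hab
    have e1 : A ^ a * A ^ b = A := by rw [← Real.rpow_add' hA (by rw [hab]; norm_num), hab, Real.rpow_one]
    have e2 : (B * t₀) ^ a * (B * t₁) ^ b = B * t := by
      rw [Real.mul_rpow hB ht₀.le, Real.mul_rpow hB ht₁.le]
      have : B ^ a * B ^ b = B := by rw [← Real.rpow_add' hB (by rw [hab]; norm_num), hab, Real.rpow_one]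
      calc B ^ a * t₀ ^ a * (B ^ b * t₁ ^ b) = (B ^ a * B ^ b) * (t₀ ^ a * t₁ ^ b) := by ring
        _ = B * t := by rw [this, htab]
    rw [e1, e2] at h; exact h
  -- Step 2: monotonicity of the geometric interpolation
  have step2 : (A + B * t₀) ^ a * (A + B * t₁) ^ b ≤
      (C * t₀ ^ l₀ * (a₁ * t₀ - c₁) ^ l₁ * (a₂ * t₀ - c₂) ^ l₂) ^ a * (C * t₁ ^ l₀ * (a₁ * t₁ - c₁) ^ l₁ * (a₂ * t₁ - c₂) ^ l₂) ^ b :=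
    mul_le_mul (Real.rpow_le_rpow hpos.le e₀ ha) (Real.rpow_le_rpow hpos₁.le e₁ hb) (Real.rpow_nonneg hpos₁.le _)
      (Real.rpow_nonneg (hR ht₀ hs₁ hs₂) _)
  -- Step 3: the geometric interpolation of the right sides, factor by factor
  have hC' : C ^ a * C ^ b = C := by rw [← Real.rpow_add' hC (by rw [hab]; norm_num), hab, Real.rpow_one]
  have hP0 : (t₀ ^ l₀) ^ a * (t₁ ^ l₀) ^ b = t ^ l₀ := by
    rw [← Real.rpow_mul ht₀.le, ← Real.rpow_mul ht₁.le, mul_comm l₀ a, mul_comm l₀ b, Real.rpow_mul ht₀.le, Real.rpow_mul ht₁.le,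
      ← Real.mul_rpow (Real.rpow_nonneg ht₀.le _) (Real.rpow_nonneg ht₁.le _), htab]
  have hP : ∀ {aa cc l : ℝ}, 0 < aa → 0 ≤ cc → cc < aa * t₀ → cc < aa * t₁ → 0 ≤ l →
      ((aa * t₀ - cc) ^ l) ^ a * ((aa * t₁ - cc) ^ l) ^ b ≤ (aa * t - cc) ^ l := by
    intro aa cc l haa hcc h0 h1' hl
    have hu : 0 < aa * t₀ - cc := sub_pos.2 h0
    have hv : 0 < aa * t₁ - cc := sub_pos.2 h1'
    rw [← Real.rpow_mul hu.le, ← Real.rpow_mul hv.le, mul_comm l a, mul_comm l b, Real.rpow_mul hu.le, Real.rpow_mul hv.le,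
      ← Real.mul_rpow (Real.rpow_nonneg hu.le _) (Real.rpow_nonneg hv.le _)]
    apply Real.rpow_le_rpow (mul_nonneg (Real.rpow_nonneg hu.le _) (Real.rpow_nonneg hv.le _)) _ hl
    have key := shifted_gm_le hcc h0 h1' ha hb hab
    have e : (aa * t₀) ^ a * (aa * t₁) ^ b = aa * t := by
      rw [Real.mul_rpow haa.le ht₀.le, Real.mul_rpow haa.le ht₁.le]
      have : aa ^ a * aa ^ b = aa := by rw [← Real.rpow_add' haa.le (by rw [hab]; norm_num), hab, Real.rpow_one]
      calc aa ^ a * t₀ ^ a * (aa ^ b * t₁ ^ b) = (aa ^ a * aa ^ b) * (t₀ ^ a * t₁ ^ b) := by ring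
        _ = aa * t := by rw [this, htab]
    rw [e] at key; exact key
  have step3 : (C * t₀ ^ l₀ * (a₁ * t₀ - c₁) ^ l₁ * (a₂ * t₀ - c₂) ^ l₂) ^ a * (C * t₁ ^ l₀ * (a₁ * t₁ - c₁) ^ l₁ * (a₂ * t₁ - c₂) ^ l₂) ^ b
      ≤ C * t ^ l₀ * (a₁ * t - c₁) ^ l₁ * (a₂ * t - c₂) ^ l₂ := by
    have n00 : 0 ≤ C * t₀ ^ l₀ := mul_nonneg hC (Real.rpow_nonneg ht₀.le _)
    have n01 : 0 ≤ (a₁ * t₀ - c₁) ^ l₁ := Real.rpow_nonneg (by linarith) _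
    have n02 : 0 ≤ (a₂ * t₀ - c₂) ^ l₂ := Real.rpow_nonneg (by linarith) _
    have n10 : 0 ≤ C * t₁ ^ l₀ := mul_nonneg hC (Real.rpow_nonneg ht₁.le _)
    have n11 : 0 ≤ (a₁ * t₁ - c₁) ^ l₁ := Real.rpow_nonneg (by linarith) _
    have n12 : 0 ≤ (a₂ * t₁ - c₂) ^ l₂ := Real.rpow_nonneg (by linarith) _
    rw [Real.mul_rpow (mul_nonneg n00 n01) n02, Real.mul_rpow n00 n01, Real.mul_rpow hC (Real.rpow_nonneg ht₀.le _),
      Real.mul_rpow (mul_nonneg n10 n11) n12, Real.mul_rpow n10 n11, Real.mul_rpow hC (Real.rpow_nonneg ht₁.le _)]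
    have f1 := hP ha₁ hc₁ hs₁ hs₁' hl₁
    have f2 := hP ha₂ hc₂ hs₂ hs₂' hl₂
    have g1 : 0 ≤ ((a₁ * t₀ - c₁) ^ l₁) ^ a * ((a₁ * t₁ - c₁) ^ l₁) ^ b := mul_nonneg (Real.rpow_nonneg n01 _) (Real.rpow_nonneg n11 _)
    have g2 : 0 ≤ ((a₂ * t₀ - c₂) ^ l₂) ^ a * ((a₂ * t₁ - c₂) ^ l₂) ^ b := mul_nonneg (Real.rpow_nonneg n02 _) (Real.rpow_nonneg n12 _)
    have gt : 0 ≤ C * t ^ l₀ := mul_nonneg hC (Real.rpow_nonneg ht.le _)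
    have gf1 : 0 ≤ (a₁ * t - c₁) ^ l₁ := Real.rpow_nonneg (by linarith) _
    calc C ^ a * (t₀ ^ l₀) ^ a * ((a₁ * t₀ - c₁) ^ l₁) ^ a * ((a₂ * t₀ - c₂) ^ l₂) ^ a *
          (C ^ b * (t₁ ^ l₀) ^ b * ((a₁ * t₁ - c₁) ^ l₁) ^ b * ((a₂ * t₁ - c₂) ^ l₂) ^ b)
        = (C ^ a * C ^ b) * ((t₀ ^ l₀) ^ a * (t₁ ^ l₀) ^ b) * (((a₁ * t₀ - c₁) ^ l₁) ^ a * ((a₁ * t₁ - c₁) ^ l₁) ^ b) *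
          (((a₂ * t₀ - c₂) ^ l₂) ^ a * ((a₂ * t₁ - c₂) ^ l₂) ^ b) := by ring
      _ = C * t ^ l₀ * (((a₁ * t₀ - c₁) ^ l₁) ^ a * ((a₁ * t₁ - c₁) ^ l₁) ^ b) *
          (((a₂ * t₀ - c₂) ^ l₂) ^ a * ((a₂ * t₁ - c₂) ^ l₂) ^ b) := by rw [hC', hP0]
      _ ≤ C * t ^ l₀ * (a₁ * t - c₁) ^ l₁ * (a₂ * t - c₂) ^ l₂ :=
          mul_le_mul (mul_le_mul_of_nonneg_left f1 gt) f2 g2 (mul_nonneg gt gf1)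
  exact step1.trans (step2.trans step3)

end Summit.CriticalPhenomena.PercolationContinuityZ3.Theorems.SunflowerPartition.SafeCalc.LinkedCurrency
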